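import Summits.Ventures.PercRepro.Night2TwoOneFloors
import Summits.Ventures.PercRepro.Night2TwoOneVFloor
import Summits.Ventures.PercRepro.Night2TwoOneSources

/-!
# PercRepro — the cell `(2, 1)` with two fat closures: THE CAPACITY FLOORS OF THE BASIS PAIRS' TARGETS
(night-2, gen 28)

Spread regime of the two-fat-closure clause (`Night2TwoOneFloors`).  For a lossy basis pair `(B, z)` (profile `(3, 2)`
along the plane `P`) every target `T = B ∪ {z} ∪ A` has, with `(i, j) = (|T′ ∩ P|, |T′ ∖ P|)`, `T′ = T ∖ K`, `n = |V|`: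
`cap3 T ≥ vTwoOne n i j` where
* `1` at the top levels `i + j ≥ n − 2` (`cap2 = 1`, no load: a loaded target misses `≥ 3` points of `G`);
* `97/108` at `i + j = n − 3` (`cap2 = 1`, load `≤ 11/108`);
* `13/27` at `j = 4`, `i ≥ 4` (no load; `L1 ≤ 7/54`); `2/9` at `(3, 4)` (`L1 ≤ 7/18`);
* `19/216` at `j = 3`, `i ≥ 4` (`L1 ≤ 91/216`, load `≤ 11/108`); `0` elsewhere (**`cap3_ge_vTwoOne`**).
-/

namespace PercRepro.Shadow

open Finset PerFlat ThmH

variable {α : Type*} [DecidableEq α] {M : Matroid α} [M.Finite]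

section FloorsB

variable {G : Finset α}

/-- The plane part of a set does not meet the coloop. -/
theorem sdiff_coloops_inter_plane {B₀ B₁ T : Finset α} :
    (T \ coloops M G) ∩ ((clF M B₀ ∩ clF M B₁) \ coloops M G) = T ∩ ((clF M B₀ ∩ clF M B₁) \ coloops M G) := by
  ext x
  simp only [Finset.mem_inter, Finset.mem_sdiff]
  tauto

/-- The off-plane part of a subset of `G` is its trace on the classes. -/
theorem sdiff_coloops_sdiff_plane {B₀ B₁ T : Finset α} (hTG : T ⊆ G) (hKH₀ : coloops M G ⊆ clF M B₀)
    (hKH₁ : coloops M G ⊆ clF M B₁) :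
    (T \ coloops M G) \ ((clF M B₀ ∩ clF M B₁) \ coloops M G) = T ∩ ((G \ clF M B₀) ∪ (G \ clF M B₁)) := by
  ext x
  simp only [Finset.mem_sdiff, Finset.mem_inter, Finset.mem_union, not_and, not_not]
  constructor
  · rintro ⟨⟨hxT, hxK⟩, h⟩
    refine ⟨hxT, ?_⟩
    by_cases h0 : x ∈ clF M B₀
    · by_cases h1 : x ∈ clF M B₁
      · exact absurd (h ⟨h0, h1⟩) hxK
      · exact Or.inr ⟨hTG hxT, h1⟩
    · exact Or.inl ⟨hTG hxT, h0⟩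
  · rintro ⟨hxT, (⟨-, h0⟩ | ⟨-, h1⟩)⟩
    · exact ⟨⟨hxT, fun hK => h0 (hKH₀ hK)⟩, fun h => absurd h.1 h0⟩
    · exact ⟨⟨hxT, fun hK => h1 (hKH₁ hK)⟩, fun h => absurd h.2 h1⟩

/-- `G ∖ (T ∖ y) = insert y (G ∖ T)` for `y ∈ T`. -/
theorem sdiff_erase_eq_insert {T : Finset α} {y : α} (hy : y ∈ T) (hyG : y ∈ G) :
    G \ T.erase y = insert y (G \ T) := by
  ext x
  simp only [Finset.mem_sdiff, Finset.mem_erase, Finset.mem_insert, not_and]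
  constructor
  · rintro ⟨hxG, h⟩
    by_cases hxy : x = y
    · exact Or.inl hxy
    · exact Or.inr ⟨hxG, h hxy⟩
  · rintro (rfl | ⟨hxG, hxT⟩)
    · exact ⟨hyG, fun h => absurd rfl h⟩
    · exact ⟨hxG, fun _ => hxT⟩

open scoped Classical in
/-- **THE CAPACITY FLOORS OF THE BASIS PAIRS' TARGETS** (cell `(2, 1)`, spread regime, two fat closures with
disjoint missed pairs, the completion rule along the off-plane points). -/
theorem cap3_ge_vTwoOne (hG : G ∈ flatsQ M (5 + 1)) (hd : (gr M \ G).card = 2) (hk : kColoops M G = 1)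
    (hs : ∀ e ∈ gr M, ∀ f ∈ gr M, e ≠ f → rkN M {e, f} = 2) (hl : ∀ e ∈ gr M, M.Indep {e})
    {B₀ B₁ : Finset α} (hB₀ : B₀ ∈ thinMembers M 5 G) (hB₁ : B₁ ∈ thinMembers M 5 G)
    (hm₀ : (G \ clF M B₀).card ≤ 2) (hm₁ : (G \ clF M B₁).card ≤ 2) (hne : clF M B₀ ≠ clF M B₁)
    (hfat : (fatClosures M 5 G 2).card ≤ 2)
    (hsp : ∀ B ∈ thinMembers M 5 G, 2 < (G \ clF M B).card → 7 ≤ (G \ clF M B).card)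
    (hdisj : Disjoint (G \ clF M B₀) (G \ clF M B₁)) {B : Finset α} (hB : B ∈ thinMembers M 5 G)
    (hB4 : (B \ coloops M G).card + 1 = 5) {z : α} (hz : z ∈ G \ clF M B) (hl0 : loss M 5 G B z ≠ 0) :
    ∀ T ∈ tgtSets M 5 G B z,
      vTwoOne (G \ coloops M G).card
        (profileAt (coloops M G) ((clF M B₀ ∩ clF M B₁) \ coloops M G) T).1
        (profileAt (coloops M G) ((clF M B₀ ∩ clF M B₁) \ coloops M G) T).2 ≤
      cap3 M 5 G (fun B => 5 ≤ (B \ coloops M G).card)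
        (dshComp M 5 G ((G \ clF M B₀) ∪ (G \ clF M B₁))) T := by
  intro T hT
  have hd' : (gr M \ G).card ≤ 5 := by omega
  have hKH₀ : coloops M G ⊆ clF M B₀ := (coloops_subset_of_mem_thinMembers hG hd' hB₀).trans
    (subset_clF (mem_membersIn.1 (mem_thinMembers.1 hB₀).1).1)
  have hKH₁ : coloops M G ⊆ clF M B₁ := (coloops_subset_of_mem_thinMembers hG hd' hB₁).trans
    (subset_clF (mem_membersIn.1 (mem_thinMembers.1 hB₁).1).1)
  have hA2 : (G \ clF M B₀).card = 2 := by
    have := two_le_card_sdiff_of_not_lay0 hG hd' (mem_thinMembers.1 hB₀).1 (mem_thinMembers.1 hB₀).2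
    omega
  have hB2 : (G \ clF M B₁).card = 2 := by
    have := two_le_card_sdiff_of_not_lay0 hG hd' (mem_thinMembers.1 hB₁).1 (mem_thinMembers.1 hB₁).2
    omega
  obtain ⟨hTsh, hQT, -⟩ := mem_tgtSets.1 hT
  have hTG : T ⊆ G := subset_G_of_mem_shadowAt hTsh
  have hKT : coloops M G ⊆ T := coloops_subset_of_mem_shadowAt hTsh
  have hT5 : rkN M (T \ coloops M G) = 5 := rkN_sdiff_coloops_eq_five_two hG hk hTsh
  -- the column bound and the load bound
  have hdl := dload_comp_two_one_le_cap2 hG hd hk hs hl hB₀ hB₁ hm₀ hm₁ hne hfat hsp hdisj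
  have hdlT := dload_comp_two_one_le hG hd hk hs hl hB₀ hB₁ hm₀ hm₁ hne hfat hsp hdisj T
  have hcap3 : 0 ≤ cap3 M 5 G (fun B => 5 ≤ (B \ coloops M G).card)
      (dshComp M 5 G ((G \ clF M B₀) ∪ (G \ clF M B₁))) T := cap3_nonneg (hdl T hTsh)
  have hdl0 : 0 ≤ dload M 5 G (fun B => 5 ≤ (B \ coloops M G).card)
      (dshComp M 5 G ((G \ clF M B₀) ∪ (G \ clF M B₁))) T :=
    dload_nonneg (fun B z S => dshComp_nonneg hG hd' _ B z S) T
  -- the profile of the lossy basis pair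
  obtain ⟨hXP3, -, hXr, ⟨u, huQ, hu⟩, ⟨u', hu'Q, hu'⟩⟩ :=
    profile_of_lossy_basis_pair hG hd hk hB₀ hB₁ hm₀ hm₁ hne hdisj hB hB4 hz hl0
  have huT : u ∈ T ∩ (G \ clF M B₀) := Finset.mem_inter.2 ⟨hQT huQ, hu⟩
  have hu'T : u' ∈ T ∩ (G \ clF M B₁) := Finset.mem_inter.2 ⟨hQT hu'Q, hu'⟩
  set n := (G \ coloops M G).card with hn
  set P := (clF M B₀ ∩ clF M B₁) \ coloops M G with hPdef
  set Xs := (G \ clF M B₀) ∪ (G \ clF M B₁) with hXs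
  obtain ⟨i, hi⟩ : ∃ i, i = (profileAt (coloops M G) P T).1 := ⟨_, rfl⟩
  obtain ⟨j, hj⟩ : ∃ j, j = (profileAt (coloops M G) P T).2 := ⟨_, rfl⟩
  rw [← hi, ← hj]
  simp only [profileAt] at hi hj
  have hTP : (T \ coloops M G) ∩ P = T ∩ P := sdiff_coloops_inter_plane
  have hTX : (T \ coloops M G) \ P = T ∩ Xs := sdiff_coloops_sdiff_plane hTG hKH₀ hKH₁
  rw [hTP] at hi
  rw [hTX] at hj
  have hij : j + i = (T \ coloops M G).card := by
    rw [hi, hj, ← hTP, ← hTX]; exact Finset.card_sdiff_add_card_inter _ _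
  have hGT : (G \ T).card + (T \ coloops M G).card = n := card_sdiff_add_eq_of_mem_shadowAt hTsh rfl
  have hTP3 : 3 ≤ rkN M (T ∩ P) := by
    refine le_trans hXr (rkN_mono ?_)
    exact Finset.inter_subset_inter (Finset.sdiff_subset.trans hQT) (Finset.Subset.refl _)
  have hi3 : 3 ≤ i := by
    rw [hi, ← hXP3]
    exact Finset.card_le_card (Finset.inter_subset_inter (Finset.sdiff_subset.trans hQT) (Finset.Subset.refl _))
  have hXs4 : Xs.card = 4 := by
    rw [hXs, Finset.card_union_of_disjoint hdisj, hA2, hB2]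
  have hcap := capS_ge_eleven_eighteenths_two_one hd hk hTG
  -- the class trace of a thin face at a class point is a singleton
  have hsing₀ : ∀ w ∈ T ∩ (G \ clF M B₀), T.erase w ∈ thinMembers M 5 G → (G \ clF M B₀) ∩ T = {w} :=
    fun w hw hthin => class_inter_eq_singleton_of_thin_face hG hd hk hB₀ hB₁ hdisj hTP3 hu'T hw hthin
  have hsing₁ : ∀ w ∈ T ∩ (G \ clF M B₁), T.erase w ∈ thinMembers M 5 G → (G \ clF M B₁) ∩ T = {w} :=
    fun w hw hthin => class_inter_eq_singleton_of_thin_face' hG hd hk hB₀ hB₁ hdisj hTP3 huT hw hthin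
  have hXsplit : (T ∩ Xs).card = ((G \ clF M B₀) ∩ T).card + ((G \ clF M B₁) ∩ T).card := by
    rw [hXs, Finset.inter_union_distrib_left, Finset.card_union_of_disjoint
      (hdisj.mono Finset.inter_subset_right Finset.inter_subset_right), Finset.inter_comm T, Finset.inter_comm T]
  unfold cap3
  unfold vTwoOne
  by_cases h1 : n ≤ i + j + 2
  · rw [if_pos h1]
    -- top levels: `cap2 = 1`, no load
    have hc2 : cap2 M 5 G T = 1 := cap2_eq_one_of_card_le hG (by omega)
    have hdl0' : dload M 5 G (fun B => 5 ≤ (B \ coloops M G).card) (dshComp M 5 G Xs) T = 0 := by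
      by_contra hne0
      obtain ⟨y, hy, -, -, -, -, -, -, -, -, -, -, -, hGQ, -⟩ :=
        card_inter_eq_three_of_dload_ne_zero hG hd hk hs hl hB₀ hB₁ hm₀ hm₁ hne hfat hsp hne0
      have hyT : y ∈ T := (Finset.mem_inter.1 hy).2
      rw [sdiff_erase_eq_insert hyT (hTG hyT), Finset.card_insert_of_notMem (fun h => (Finset.mem_sdiff.1 h).2 hyT)]
        at hGQ
      omega
    rw [hc2, hdl0']
    norm_num
  · rw [if_neg h1]
    by_cases h2 : i + j + 3 = n
    · rw [if_pos h2]
      have hc2 : cap2 M 5 G T = 1 := cap2_eq_one_of_card_le hG (by omega)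
      rw [hc2]
      linarith
    · rw [if_neg h2]
      by_cases h3 : j = 4
      · rw [if_pos h3]
        -- all four off-plane points lie in `T`: no load, no thin face at a class point
        have hTXs : T ∩ Xs = Xs := by
          apply Finset.eq_of_subset_of_card_le Finset.inter_subset_right
          rw [hXs4, ← hj, h3]
        have hA : G \ clF M B₀ ⊆ T := by
          intro x hx
          have : x ∈ T ∩ Xs := by rw [hTXs]; exact Finset.mem_union_left _ hx
          exact (Finset.mem_inter.1 this).1
        have hB' : G \ clF M B₁ ⊆ T := by
          intro x hx
          have : x ∈ T ∩ Xs := by rw [hTXs]; exact Finset.mem_union_right _ hx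
          exact (Finset.mem_inter.1 this).1
        have hdl0' : dload M 5 G (fun B => 5 ≤ (B \ coloops M G).card) (dshComp M 5 G Xs) T = 0 := by
          apply dload_comp_two_one_eq_zero_of_card_ne hG hd hk hs hl hB₀ hB₁ hm₀ hm₁ hne hfat hsp
          rw [← hXs, ← hj, h3]; norm_num
        rw [hdl0', sub_zero]
        by_cases h4 : 4 ≤ i
        · rw [if_pos h4]
          -- `L1 ≤ 7/54`
          have hL1 := L1_le_of_spanning hG hd hk hs hB₀ hB₁ hm₀ hm₁ hne hfat hsp hdisj hTG hTP3 (hi ▸ h4) huT hu'T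
          have hWX : ((T ∩ Xs).filter (fun w => T.erase w ∈ thinMembers M 5 G)) = ∅ := by
            rw [Finset.filter_eq_empty_iff]
            intro w hw hthin
            rw [Finset.mem_inter, hXs, Finset.mem_union] at hw
            rcases hw.2 with h | h
            · have := hsing₀ w (Finset.mem_inter.2 ⟨hw.1, h⟩) hthin
              rw [Finset.inter_eq_left.2 hA] at this
              have := congrArg Finset.card this
              rw [hA2, Finset.card_singleton] at this
              omega
            · have := hsing₁ w (Finset.mem_inter.2 ⟨hw.1, h⟩) hthin
              rw [Finset.inter_eq_left.2 hB'] at this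
              have := congrArg Finset.card this
              rw [hB2, Finset.card_singleton] at this
              omega
          rw [← hXs, hWX, Finset.card_empty] at hL1
          have hL1' : L1 M 5 G T ≤ 7 / 54 := by norm_num at hL1; linarith
          have hfS : fS M 5 G T = 1 := by
            unfold fS; rw [if_pos (by linarith)]
          unfold cap2
          rw [hfS, one_mul]
          linarith
        · rw [if_neg h4]
          -- `(3, 4)`: `L1 ≤ 7/18`
          have hL1 := L1_le_of_complete hG hd hk hs hl hB₀ hB₁ hm₀ hm₁ hne hfat hsp hdisj hTG hT5 (by omega)
            hTP3 hA hB'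
          have hfS : fS M 5 G T = 1 := by
            unfold fS; rw [if_pos (by linarith)]
          unfold cap2
          rw [hfS, one_mul]
          linarith
      · rw [if_neg h3]
        by_cases h5 : j = 3
        · rw [if_pos h5]
          by_cases h6 : 4 ≤ i
          · rw [if_pos h6]
            -- `L1 ≤ 7/24 + 7/54`, load `≤ 11/108`
            have hL1 := L1_le_of_spanning hG hd hk hs hB₀ hB₁ hm₀ hm₁ hne hfat hsp hdisj hTG hTP3 (hi ▸ h6) huT hu'T
            have hWX : ((T ∩ Xs).filter (fun w => T.erase w ∈ thinMembers M 5 G)).card ≤ 1 := by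
              apply Finset.card_le_one.2
              intro w₁ hw₁ w₂ hw₂
              rw [Finset.mem_filter, Finset.mem_inter, hXs, Finset.mem_union] at hw₁ hw₂
              rcases hw₁.1.2 with h₁ | h₁ <;> rcases hw₂.1.2 with h₂ | h₂
              · have e₁ := hsing₀ w₁ (Finset.mem_inter.2 ⟨hw₁.1.1, h₁⟩) hw₁.2
                have e₂ := hsing₀ w₂ (Finset.mem_inter.2 ⟨hw₂.1.1, h₂⟩) hw₂.2
                exact Finset.singleton_injective (e₁.symm.trans e₂)
              · exfalso
                have e₁ := hsing₀ w₁ (Finset.mem_inter.2 ⟨hw₁.1.1, h₁⟩) hw₁.2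
                have e₂ := hsing₁ w₂ (Finset.mem_inter.2 ⟨hw₂.1.1, h₂⟩) hw₂.2
                rw [e₁, e₂, Finset.card_singleton, Finset.card_singleton] at hXsplit
                omega
              · exfalso
                have e₁ := hsing₁ w₁ (Finset.mem_inter.2 ⟨hw₁.1.1, h₁⟩) hw₁.2
                have e₂ := hsing₀ w₂ (Finset.mem_inter.2 ⟨hw₂.1.1, h₂⟩) hw₂.2
                rw [e₁, e₂, Finset.card_singleton, Finset.card_singleton] at hXsplit
                omega
              · have e₁ := hsing₁ w₁ (Finset.mem_inter.2 ⟨hw₁.1.1, h₁⟩) hw₁.2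
                have e₂ := hsing₁ w₂ (Finset.mem_inter.2 ⟨hw₂.1.1, h₂⟩) hw₂.2
                exact Finset.singleton_injective (e₁.symm.trans e₂)
            have hWX' : ((((T ∩ Xs).filter (fun w => T.erase w ∈ thinMembers M 5 G)).card : ℕ) : ℚ) ≤ 1 := by
              exact_mod_cast hWX
            rw [← hXs] at hL1
            have hL1' : L1 M 5 G T ≤ 91 / 216 := by nlinarith
            have hfS : fS M 5 G T = 1 := by
              unfold fS; rw [if_pos (by linarith)]
            unfold cap2
            rw [hfS, one_mul]
            linarith
          · rw [if_neg h6]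
            exact hcap3
        · rw [if_neg h5]
          exact hcap3

end FloorsB

end PercRepro.Shadow
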